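/-
Copyright (c) 2026 the pub-hodgecm-mathlib formalisation cell (harness21).  Prover seat hodgecm-mathlib-K2Liu-p11 (g0), Track B «K2-LIT»,
#184♮ = hLiu418 = `stmt-HodgeConjecture-24832`; LEAD F0P6-plan (g12) DEAL 2026-09-04T06:56:46Z «(C) FIRST, THEN (H1-E)», SIGS-RoadI-v3 §Hol
row H1-E (K2E5-plan (g5)), file E-1 of H1-E (REPORT-H1E-CENSUS.K2Liu-p11-g0.md §4).  THEOREMS ONLY (no `def`, no `instance`, no notation,
no named-fact hypothesis, no `sorry`).
-/
import Summits.HodgeConjecture.HodgeConjecture.Theorems.K2LiuHermitianTubeCocycle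
import Mathlib.Analysis.Calculus.MeanValue
import Mathlib.Analysis.Normed.Algebra.MatrixExponential
import Mathlib.Topology.Algebra.Module.FiniteDimension
import HarnessLib

/-!
# Crux `HLiu418`, Road I, organ H1-E (hermitian-tube Cauchy–Riemann dictionary), file E-1:
# Fréchet differentiability at the base point from right Lie derivatives along one-parameter subgroups

Cell `hodgecm-mathlib`, crux item hLiu418 = `stmt-HodgeConjecture-24832` (helper lane `--supports`, count-neutral).

This is the «continuous Lie derivatives along all left-invariant fields ⇒ differentiable» step that SIGS-RoadI-v3 §Hol singles out as
the one risky lemma of H1-E («the ball lane has it: cite/port» — in fact the ball lane ★ `UnitaryBallLieDerivative` ASSUMES chart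
differentiability `IsArchSmooth`; here it is PROVED, in the form H1-E needs: differentiability AT THE ORIGIN of the exponential chart,
which is all the inverse-function-theorem step of E-2/E-4 consumes).

* §1 `hasFDerivAt_zero_of_blockRays` (abstract, Mathlib-only): `f : (ι → E₀) → F` on a finite product of real normed blocks is Fréchet
  differentiable at `0` with derivative `y ↦ Σ_i ℓ_i(0)(y_i)` as soon as, for every base point `x`, the block ray
  `τ ↦ f (update x i (τ • w))` has derivative `ℓ_i (update x i (τ • w)) w` at every `τ`, and each `ℓ_i` is continuous at `0`
  (operator norm).  Proof: switch the blocks on one at a time (`Finset` induction) and bound each step by the 1-D mean value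
  inequality ★ `norm_image_sub_le_of_norm_deriv_le_segment_01'`; only rays THROUGH THE BLOCK ORIGIN are used — exactly what
  one-parameter subgroups supply (`exp ((t+τ)Y) = exp (tY) exp (τY)`), no inverse function theorem, no matrix logarithm.
* §2 (matrix group `U(J) = {g | gᴴ J g = J}`, `J = Matrix.J l ℂ`, Lie algebra `{Y | Yᴴ J + J Y = 0}`): `exp (t • Y) ∈ U(J)`
  (`conjTranspose_exp_mul_J_mul_exp`, algebraic: `(t•Y)ᴴ = J (−t•Y) J⁻¹`, ★ `Matrix.exp_conjTranspose`, `Matrix.exp_units_conj`,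
  `Matrix.exp_neg`), `exp ((t + τ) • Y) = exp (t • Y) * exp (τ • Y)`, continuity of the matrix exponential.
* §3 `exists_hasFDerivAt_placewiseExp` (THE E-1 HEAD): for `Φ : (σ → M_{2n}(ℂ)) → ℂ` with right Lie derivatives `D s Y g` along
  `t ↦ update g s (g s * exp (t • Y))` at every `g ∈ U(J)^σ` and every `Y ∈ 𝔤` (hypothesis (L) of the H1-E face), linear in `Y` (L-lin)
  and continuous on `U(J)^σ` (hDc), and any real-linear `Λ : E₀ →L[ℝ] 𝔤`, the pull-back `y ↦ Φ (fun s => g₀ s * exp (Λ (y s)))` is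
  Fréchet differentiable at `0` with derivative `y ↦ Σ_s D s (Λ (y s)) g₀`.

No matrix norm occurs in any statement (`NormedSpace.exp` needs only the topology); inside the proof of `continuous_matrix_exp` the
`L∞`-operator norm is installed with `letI`, Mathlib's own idiom in `MatrixExponential`.
References: [Bump1997, §2.1–§3.2] (Lie derivatives of automorphic forms, the `SL₂(ℝ)` prototype); [Knapp1986, Ch. I §1] (one-parameter
subgroups; folklore calculus).  HONEST LABEL: HC_CM is proved only modulo the 7 printed citations (2 remaining named inputs:
hLiu418 = stmt-HodgeConjecture-24832, h413 = stmt-HodgeConjecture-24833) until rung 0 closes; count-neutral helper, closes no socket.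
-/

set_option autoImplicit false
set_option linter.dupNamespace false

noncomputable section

open scoped Matrix Topology
open Filter Asymptotics Set NormedSpace
open Summit.HodgeConjecture.HodgeConjecture.Cruxes.HLiu418.K2LiuHermitianTubeCocycle (mul_mem_UJ)

namespace Summit.HodgeConjecture.HodgeConjecture.Cruxes.HLiu418.K2LiuLieRayDifferentiability

/-! ## §1 Fréchet differentiability at `0` from block rays through the block origins -/

section BlockRay

variable {ι : Type*} [DecidableEq ι] {E₀ F : Type*} [NormedAddCommGroup E₀] [NormedAddCommGroup F]

/-- The truncation of `y` to the blocks in `T` has norm `≤ ‖y‖`. [folklore] -/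
theorem norm_truncate_le [Fintype ι] (y : ι → E₀) (T : Finset ι) :
    ‖(fun i => if i ∈ T then y i else 0)‖ ≤ ‖y‖ := by
  refine (pi_norm_le_iff_of_nonneg (norm_nonneg y)).2 fun i => ?_
  by_cases hi : i ∈ T
  · simp only [hi, if_true]; exact norm_le_pi_norm y i
  · simp only [hi, if_false, norm_zero]; exact norm_nonneg y

/-- A truncation updated by a partial step `τ • y a` (`0 ≤ τ ≤ 1`) in the block `a` still has norm `≤ ‖y‖`. [folklore] -/
theorem norm_update_truncate_le [Fintype ι] [NormedSpace ℝ E₀] (y : ι → E₀) (T : Finset ι) (a : ι)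
    {τ : ℝ} (hτ0 : 0 ≤ τ) (hτ1 : τ ≤ 1) :
    ‖Function.update (fun i => if i ∈ T then y i else 0) a (τ • y a)‖ ≤ ‖y‖ := by
  refine (pi_norm_le_iff_of_nonneg (norm_nonneg y)).2 fun i => ?_
  by_cases hia : i = a
  · subst hia
    rw [Function.update_self, norm_smul, Real.norm_eq_abs, abs_of_nonneg hτ0]
    calc τ * ‖y i‖ ≤ 1 * ‖y i‖ := by gcongr
      _ = ‖y i‖ := one_mul _
      _ ≤ ‖y‖ := norm_le_pi_norm y i
  · rw [Function.update_of_ne hia]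
    by_cases hi : i ∈ T
    · simp only [hi, if_true]; exact norm_le_pi_norm y i
    · simp only [hi, if_false, norm_zero]; exact norm_nonneg y

/-- Switching on one more block: `y^{insert a T} = update (y^T) a (y a)`. [folklore] -/
theorem truncate_insert (y : ι → E₀) (T : Finset ι) {a : ι} (ha : a ∉ T) :
    (fun i => if i ∈ insert a T then y i else 0) =
      Function.update (fun i => if i ∈ T then y i else 0) a (y a) := by
  funext i
  by_cases hia : i = a
  · subst hia
    simp
  · rw [Function.update_of_ne hia]
    simp [Finset.mem_insert, hia]

/-- **Fréchet differentiability at `0` from block rays through the block origins.**  Let `f : (ι → E₀) → F` and, for each block `i`,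
a field of would-be block partials `ℓ i : (ι → E₀) → (E₀ →L[ℝ] F)` continuous at `0`.  If for every base point `x` the block ray
`τ ↦ f (update x i (τ • w))` (through the ORIGIN of block `i`) has derivative `ℓ i (update x i (τ • w)) w` at every `τ`, then `f` is
Fréchet differentiable at `0` with derivative `y ↦ Σ_i ℓ i 0 (y i)`.  (Rays through the block origin are what one-parameter subgroups
provide.) [folklore] -/
theorem hasFDerivAt_zero_of_blockRays [Fintype ι] [NormedSpace ℝ E₀] [NormedSpace ℝ F] (f : (ι → E₀) → F)
    (ℓ : ι → (ι → E₀) → (E₀ →L[ℝ] F))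
    (hℓ : ∀ i, ContinuousAt (ℓ i) 0)
    (hf : ∀ (x : ι → E₀) (i : ι) (w : E₀) (t : ℝ),
      HasDerivAt (fun τ : ℝ => f (Function.update x i (τ • w))) (ℓ i (Function.update x i (t • w)) w) t) :
    HasFDerivAt f (∑ i, (ℓ i 0).comp (ContinuousLinearMap.proj i)) 0 := by
  rw [hasFDerivAt_iff_isLittleO_nhds_zero]
  refine isLittleO_iff.2 fun c hc => ?_
  -- the tolerance per block
  set ε : ℝ := c / (Fintype.card ι + 1) with hε
  have hε0 : 0 < ε := by positivity
  have hεc : (Fintype.card ι : ℝ) * ε ≤ c := by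
    rw [hε, mul_div_assoc', div_le_iff₀ (by positivity)]
    nlinarith [hc.le]
  -- a radius on which every `ℓ i` is `ε`-close to `ℓ i 0`
  have hev : ∀ᶠ x in 𝓝 (0 : ι → E₀), ∀ i, ‖ℓ i x - ℓ i 0‖ ≤ ε := by
    refine eventually_all.2 fun i => ?_
    have h := Metric.tendsto_nhds.1 (hℓ i) ε hε0
    filter_upwards [h] with x hx
    rw [dist_eq_norm] at hx
    exact hx.le
  obtain ⟨δ, hδ, hδε⟩ := Metric.eventually_nhds_iff.1 hev
  refine Metric.eventually_nhds_iff.2 ⟨δ, hδ, fun y hy => ?_⟩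
  rw [dist_zero_right] at hy
  -- one block step, by the 1-D mean value inequality along a ray through the block origin
  have hstep : ∀ (x : ι → E₀) (a : ι), x a = 0 →
      (∀ τ : ℝ, 0 ≤ τ → τ ≤ 1 → ‖Function.update x a (τ • y a)‖ < δ) →
      ‖f (Function.update x a (y a)) - ℓ a 0 (y a) - f x‖ ≤ ε * ‖y‖ := by
    intro x a hxa hxδ
    have hg : ∀ τ ∈ Icc (0 : ℝ) 1, HasDerivWithinAt
        (fun τ : ℝ => f (Function.update x a (τ • y a)) - τ • ℓ a 0 (y a))
        (ℓ a (Function.update x a (τ • y a)) (y a) - (1 : ℝ) • ℓ a 0 (y a)) (Icc (0 : ℝ) 1) τ := by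
      intro τ _
      have h1 : HasDerivAt (fun τ : ℝ => f (Function.update x a (τ • y a)))
          (ℓ a (Function.update x a (τ • y a)) (y a)) τ := hf x a (y a) τ
      have h2 : HasDerivAt (fun τ : ℝ => τ • ℓ a 0 (y a)) ((1 : ℝ) • ℓ a 0 (y a)) τ :=
        (hasDerivAt_id' τ).smul_const (ℓ a 0 (y a))
      exact (h1.sub h2).hasDerivWithinAt
    have hbound : ∀ τ ∈ Ico (0 : ℝ) 1,
        ‖ℓ a (Function.update x a (τ • y a)) (y a) - (1 : ℝ) • ℓ a 0 (y a)‖ ≤ ε * ‖y‖ := by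
      intro τ hτ
      have hclose : ‖ℓ a (Function.update x a (τ • y a)) - ℓ a 0‖ ≤ ε := by
        refine hδε ?_ a
        rw [dist_zero_right]
        exact hxδ τ hτ.1 hτ.2.le
      have happ : ℓ a (Function.update x a (τ • y a)) (y a) - (1 : ℝ) • ℓ a 0 (y a) =
          (ℓ a (Function.update x a (τ • y a)) - ℓ a 0) (y a) := by
        rw [one_smul]; rfl
      rw [happ]
      calc ‖(ℓ a (Function.update x a (τ • y a)) - ℓ a 0) (y a)‖
          ≤ ‖ℓ a (Function.update x a (τ • y a)) - ℓ a 0‖ * ‖y a‖ := ContinuousLinearMap.le_opNorm _ _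
        _ ≤ ε * ‖y‖ := mul_le_mul hclose (norm_le_pi_norm y a) (norm_nonneg _) hε0.le
    have hmvt := norm_image_sub_le_of_norm_deriv_le_segment_01' hg hbound
    have hx0 : Function.update x a (0 : E₀) = x := by
      rw [← hxa, Function.update_eq_self]
    simp only [one_smul, zero_smul, sub_zero] at hmvt
    rwa [hx0] at hmvt
  -- switch the blocks on one at a time
  have key : ∀ T : Finset ι,
      ‖f (fun i => if i ∈ T then y i else 0) - f 0 - ∑ i ∈ T, ℓ i 0 (y i)‖ ≤ T.card * (ε * ‖y‖) := by
    intro T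
    induction T using Finset.induction_on with
    | empty =>
      have h0 : (fun i : ι => if i ∈ (∅ : Finset ι) then y i else 0) = 0 := by
        funext i; simp
      rw [h0, Finset.sum_empty, Finset.card_empty, sub_self, zero_sub, norm_neg, norm_zero]
      simp
    | @insert a T ha ih =>
      rw [truncate_insert y T ha, Finset.sum_insert ha, Finset.card_insert_of_notMem ha]
      have hxa : (fun i => if i ∈ T then y i else (0 : E₀)) a = 0 := by
        simp only [ha, if_false]
      have hxδ : ∀ τ : ℝ, 0 ≤ τ → τ ≤ 1 →
          ‖Function.update (fun i => if i ∈ T then y i else (0 : E₀)) a (τ • y a)‖ < δ :=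
        fun τ h0 h1 => lt_of_le_of_lt (norm_update_truncate_le y T a h0 h1) hy
      have hS := hstep _ a hxa hxδ
      have hsplit : f (Function.update (fun i => if i ∈ T then y i else (0 : E₀)) a (y a)) - f 0 -
            (ℓ a 0 (y a) + ∑ i ∈ T, ℓ i 0 (y i)) =
          (f (Function.update (fun i => if i ∈ T then y i else (0 : E₀)) a (y a)) - ℓ a 0 (y a) -
              f (fun i => if i ∈ T then y i else 0)) +
            (f (fun i => if i ∈ T then y i else 0) - f 0 - ∑ i ∈ T, ℓ i 0 (y i)) := by
        abel
      rw [hsplit]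
      refine (norm_add_le _ _).trans ?_
      refine (add_le_add hS ih).trans ?_
      push_cast
      linarith
  have hfin := key Finset.univ
  simp only [Finset.mem_univ, if_true, Finset.card_univ] at hfin
  have hL : (∑ i, (ℓ i 0).comp (ContinuousLinearMap.proj i)) y = ∑ i, ℓ i 0 (y i) := by
    rw [FunLike.coe_sum, Finset.sum_apply]
    rfl
  rw [zero_add, hL]
  calc ‖f y - f 0 - ∑ i, ℓ i 0 (y i)‖ ≤ Fintype.card ι * (ε * ‖y‖) := hfin
    _ = (Fintype.card ι * ε) * ‖y‖ := by ring
    _ ≤ c * ‖y‖ := by gcongr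

end BlockRay

/-! ## §2 The matrix group `U(J)`: one-parameter subgroups stay in the group -/

section MatrixGroup

variable {l : Type*} [Fintype l] [DecidableEq l]

/-- `J⁻¹`-free form of `Yᴴ J + J Y = 0`: `Yᴴ = J Y J` (as `J² = −1`). [cite: Shimura1997, §5.1] -/
theorem conjTranspose_eq_of_mem_lie {Y : Matrix (l ⊕ l) (l ⊕ l) ℂ} (hY : Yᴴ * Matrix.J l ℂ + Matrix.J l ℂ * Y = 0) :
    Yᴴ = Matrix.J l ℂ * Y * Matrix.J l ℂ := by
  have h1 : Yᴴ * Matrix.J l ℂ = -(Matrix.J l ℂ * Y) := eq_neg_of_add_eq_zero_left hY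
  calc Yᴴ = Yᴴ * Matrix.J l ℂ * Matrix.J l ℂ * (-1) := by
        rw [Matrix.mul_assoc Yᴴ, Matrix.J_squared]; simp
    _ = Matrix.J l ℂ * Y * Matrix.J l ℂ := by
        rw [h1]; simp [Matrix.mul_assoc]

/-- **One-parameter subgroups of `𝔲(J)` lie in `U(J)`**: if `Yᴴ J + J Y = 0` then `(exp (t•Y))ᴴ J exp (t•Y) = J` for every real `t`.
[cite: Knapp1986, Ch. I §1] -/
theorem conjTranspose_exp_mul_J_mul_exp {Y : Matrix (l ⊕ l) (l ⊕ l) ℂ} (hY : Yᴴ * Matrix.J l ℂ + Matrix.J l ℂ * Y = 0)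
    (t : ℝ) : (exp (t • Y))ᴴ * Matrix.J l ℂ * exp (t • Y) = Matrix.J l ℂ := by
  -- `J` as a unit, with inverse `−J`
  set U : (Matrix (l ⊕ l) (l ⊕ l) ℂ)ˣ :=
    ⟨Matrix.J l ℂ, -Matrix.J l ℂ, by rw [Matrix.mul_neg, Matrix.J_squared, neg_neg],
      by rw [Matrix.neg_mul, Matrix.J_squared, neg_neg]⟩ with hU
  have hUv : (U : Matrix (l ⊕ l) (l ⊕ l) ℂ) = Matrix.J l ℂ := rfl
  have hUi : ((U⁻¹ : (Matrix (l ⊕ l) (l ⊕ l) ℂ)ˣ) : Matrix (l ⊕ l) (l ⊕ l) ℂ) = -Matrix.J l ℂ := rfl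
  -- `(t•Y)ᴴ = U (−t•Y) U⁻¹`
  have hconj : (t • Y)ᴴ = (U : Matrix (l ⊕ l) (l ⊕ l) ℂ) * (-(t • Y)) * (U⁻¹ : (Matrix (l ⊕ l) (l ⊕ l) ℂ)ˣ) := by
    rw [hUv, hUi, Matrix.conjTranspose_smul, conjTranspose_eq_of_mem_lie hY]
    simp
  have hexpH : (exp (t • Y))ᴴ = Matrix.J l ℂ * (exp (t • Y))⁻¹ * (-Matrix.J l ℂ) := by
    rw [← Matrix.exp_conjTranspose, hconj, Matrix.exp_units_conj, Matrix.exp_neg, hUv, hUi]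
  have hdet : IsUnit (exp (t • Y)).det := (Matrix.isUnit_iff_isUnit_det _).1 (Matrix.isUnit_exp _)
  calc (exp (t • Y))ᴴ * Matrix.J l ℂ * exp (t • Y)
      = Matrix.J l ℂ * (exp (t • Y))⁻¹ * (-(Matrix.J l ℂ * Matrix.J l ℂ)) * exp (t • Y) := by
        rw [hexpH]; simp [Matrix.mul_assoc]
    _ = Matrix.J l ℂ := by
        rw [Matrix.J_squared, neg_neg, Matrix.mul_one, Matrix.mul_assoc, Matrix.nonsing_inv_mul _ hdet, Matrix.mul_one]

/-- `exp ((t + τ) • Y) = exp (t • Y) * exp (τ • Y)`. [folklore] -/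
theorem exp_add_smul {m : Type*} [Fintype m] [DecidableEq m] (Y : Matrix m m ℂ) (t τ : ℝ) :
    exp ((t + τ) • Y) = exp (t • Y) * exp (τ • Y) := by
  rw [add_smul]
  exact Matrix.exp_add_of_commute _ _ (((Commute.refl Y).smul_left t).smul_right τ)

set_option backward.isDefEq.respectTransparency false in
/-- The matrix exponential is continuous (for the entrywise topology; the `L∞`-operator norm is opened inside the proof only,
Mathlib's idiom in `MatrixExponential`). [folklore] -/
theorem continuous_matrix_exp {m : Type*} [Fintype m] [DecidableEq m] :
    Continuous fun A : Matrix m m ℂ => exp A :=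
  open scoped Matrix.Norms.Operator in NormedSpace.exp_continuous

end MatrixGroup

/-! ## §3 The E-1 head: the placewise exponential pull-back of `Φ` is differentiable at `0` -/

section Placewise

variable {σ : Type*} [Fintype σ] [DecidableEq σ] {n : ℕ}
  {E₀ : Type*} [NormedAddCommGroup E₀] [NormedSpace ℝ E₀] [FiniteDimensional ℝ E₀]

/-- **E-1 HEAD.**  Let `Φ : (σ → M_{2n}(ℂ)) → ℂ` have right Lie derivatives `D s Y g` along every one-parameter subgroup of `𝔲(J)` at
every place `s` and every `g ∈ U(J)^σ` — hypothesis (L) of the H1-E face —, linear in `Y` (L-lin) and continuous on `U(J)^σ` (hDc).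
Then for every `g₀ ∈ U(J)^σ` and every real-linear `Λ : E₀ →L[ℝ] 𝔲(J)` the pull-back `y ↦ Φ (s ↦ g₀ s · exp (Λ (y s)))` is Fréchet
differentiable at `0`, with derivative `y ↦ Σ_s D s (Λ (y s)) g₀`. [cite: Bump1997, §2.1] -/
theorem exists_hasFDerivAt_placewiseExp (Φ : (σ → Matrix (Fin n ⊕ Fin n) (Fin n ⊕ Fin n) ℂ) → ℂ)
    (D : σ → Matrix (Fin n ⊕ Fin n) (Fin n ⊕ Fin n) ℂ → (σ → Matrix (Fin n ⊕ Fin n) (Fin n ⊕ Fin n) ℂ) → ℂ)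
    (hD : ∀ (s : σ) (Y : Matrix (Fin n ⊕ Fin n) (Fin n ⊕ Fin n) ℂ) (g : σ → Matrix (Fin n ⊕ Fin n) (Fin n ⊕ Fin n) ℂ),
      Yᴴ * Matrix.J (Fin n) ℂ + Matrix.J (Fin n) ℂ * Y = 0 →
      (∀ s', (g s')ᴴ * Matrix.J (Fin n) ℂ * g s' = Matrix.J (Fin n) ℂ) →
      HasDerivAt (fun t : ℝ => Φ (Function.update g s (g s * exp (t • Y)))) (D s Y g) 0)
    (hDl : ∀ (s : σ) (g : σ → Matrix (Fin n ⊕ Fin n) (Fin n ⊕ Fin n) ℂ) (a : ℝ)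
      (Y Y' : Matrix (Fin n ⊕ Fin n) (Fin n ⊕ Fin n) ℂ),
      Yᴴ * Matrix.J (Fin n) ℂ + Matrix.J (Fin n) ℂ * Y = 0 → Y'ᴴ * Matrix.J (Fin n) ℂ + Matrix.J (Fin n) ℂ * Y' = 0 →
      (∀ s', (g s')ᴴ * Matrix.J (Fin n) ℂ * g s' = Matrix.J (Fin n) ℂ) →
      D s (a • Y + Y') g = (a : ℂ) * D s Y g + D s Y' g)
    (hDc : ∀ (s : σ) (Y : Matrix (Fin n ⊕ Fin n) (Fin n ⊕ Fin n) ℂ), Yᴴ * Matrix.J (Fin n) ℂ + Matrix.J (Fin n) ℂ * Y = 0 →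
      ContinuousOn (D s Y) {g | ∀ s', (g s')ᴴ * Matrix.J (Fin n) ℂ * g s' = Matrix.J (Fin n) ℂ})
    (Λ : E₀ →L[ℝ] Matrix (Fin n ⊕ Fin n) (Fin n ⊕ Fin n) ℂ)
    (hΛ : ∀ w, (Λ w)ᴴ * Matrix.J (Fin n) ℂ + Matrix.J (Fin n) ℂ * Λ w = 0)
    (g₀ : σ → Matrix (Fin n ⊕ Fin n) (Fin n ⊕ Fin n) ℂ) (hg₀ : ∀ s, (g₀ s)ᴴ * Matrix.J (Fin n) ℂ * g₀ s = Matrix.J (Fin n) ℂ) :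
    ∃ L : (σ → E₀) →L[ℝ] ℂ, (∀ y, L y = ∑ s, D s (Λ (y s)) g₀) ∧
      HasFDerivAt (fun y : σ → E₀ => Φ (fun s => g₀ s * exp (Λ (y s)))) L 0 := by
  -- abbreviations
  set J : Matrix (Fin n ⊕ Fin n) (Fin n ⊕ Fin n) ℂ := Matrix.J (Fin n) ℂ with hJ
  -- the moving base point `x ↦ (g₀ s · exp (Λ (x s)))_s` stays in `U(J)^σ` and is continuous
  have hexp1 : ∀ w : E₀, (exp (Λ w))ᴴ * J * exp (Λ w) = J := by
    intro w
    have h := conjTranspose_exp_mul_J_mul_exp (hΛ w) 1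
    rwa [one_smul] at h
  have hG : ∀ x : σ → E₀, ∀ s', (g₀ s' * exp (Λ (x s')))ᴴ * J * (g₀ s' * exp (Λ (x s'))) = J :=
    fun x s' => mul_mem_UJ (hg₀ s') (hexp1 (x s'))
  have hGc : Continuous fun x : σ → E₀ => fun s => g₀ s * exp (Λ (x s)) :=
    continuous_pi fun s => continuous_const.mul
      (continuous_matrix_exp.comp (Λ.continuous.comp (continuous_apply s)))
  -- `D s 0 g = 0` on the group
  have hD0 : ∀ s (g : σ → Matrix (Fin n ⊕ Fin n) (Fin n ⊕ Fin n) ℂ),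
      (∀ s', (g s')ᴴ * J * g s' = J) → D s 0 g = 0 := by
    intro s g hg
    have h := hDl s g 1 0 0 (by simp) (by simp) hg
    simp only [one_smul, add_zero, Complex.ofReal_one, one_mul] at h
    linear_combination -h
  -- the block partial at the point `x`, block `s`, as a continuous linear map
  have hlin : ∀ (s : σ) (x : σ → E₀), ∃ T : E₀ →L[ℝ] ℂ,
      ∀ w, T w = D s (Λ w) (fun s' => g₀ s' * exp (Λ (x s'))) := by
    intro s x
    refine ⟨LinearMap.toContinuousLinearMap
      { toFun := fun w => D s (Λ w) (fun s' => g₀ s' * exp (Λ (x s')))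
        map_add' := fun w₁ w₂ => ?_
        map_smul' := fun a w => ?_ }, fun w => rfl⟩
    · have h := hDl s _ 1 (Λ w₁) (Λ w₂) (hΛ w₁) (hΛ w₂) (hG x)
      rw [one_smul, Complex.ofReal_one, one_mul] at h
      rw [map_add, h]
    · have h := hDl s _ a (Λ w) 0 (hΛ w) (by simp) (hG x)
      rw [add_zero, hD0 s _ (hG x), add_zero] at h
      rw [map_smul, h, RingHom.id_apply, Complex.real_smul]
  choose ℓ hℓ using hlin
  -- continuity of `ℓ s` at `0` (operator norm ⇐ pointwise, `E₀` finite-dimensional)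
  have hℓc : ∀ s, ContinuousAt (ℓ s) 0 := by
    intro s
    have hcont : Continuous (ℓ s) := by
      refine continuous_clm_apply.2 fun w => ?_
      have h1 : Continuous fun x : σ → E₀ => D s (Λ w) (fun s' => g₀ s' * exp (Λ (x s'))) :=
        (hDc s (Λ w) (hΛ w)).comp_continuous hGc fun x => hG x
      exact h1.congr fun x => (hℓ s x w).symm
    exact hcont.continuousAt
  -- the derivative
  refine ⟨∑ s, (ℓ s 0).comp (ContinuousLinearMap.proj s), fun y => ?_, ?_⟩
  · rw [FunLike.coe_sum, Finset.sum_apply]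
    refine Finset.sum_congr rfl fun s _ => ?_
    rw [ContinuousLinearMap.comp_apply, ContinuousLinearMap.proj_apply, hℓ s 0 (y s)]
    congr 1
    funext s'
    rw [Pi.zero_apply, map_zero, NormedSpace.exp_zero, Matrix.mul_one]
  · refine hasFDerivAt_zero_of_blockRays _ ℓ hℓc fun x i w t => ?_
    -- the ray in block `i` through the block origin is a one-parameter-subgroup orbit
    rw [hℓ i]
    have hray : ∀ τ : ℝ, (fun s => g₀ s * exp (Λ (Function.update x i (τ • w) s))) =
        Function.update (fun s => g₀ s * exp (Λ (x s))) i (g₀ i * exp (τ • Λ w)) := by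
      intro τ
      funext s
      by_cases hsi : s = i
      · subst hsi
        rw [Function.update_self, Function.update_self, map_smul]
      · rw [Function.update_of_ne hsi, Function.update_of_ne hsi]
    simp_rw [hray]
    -- shift the base point to `t`
    set g₁ : σ → Matrix (Fin n ⊕ Fin n) (Fin n ⊕ Fin n) ℂ :=
      Function.update (fun s => g₀ s * exp (Λ (x s))) i (g₀ i * exp (t • Λ w)) with hg₁
    have hg₁U : ∀ s', (g₁ s')ᴴ * J * g₁ s' = J := by
      intro s'
      by_cases hsi : s' = i
      · subst hsi
        simp only [hg₁, Function.update_self]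
        exact mul_mem_UJ (hg₀ s') (conjTranspose_exp_mul_J_mul_exp (hΛ w) t)
      · simp only [hg₁, Function.update_of_ne hsi]
        exact hG x s'
    have hshift : ∀ τ : ℝ, Function.update (fun s => g₀ s * exp (Λ (x s))) i (g₀ i * exp (τ • Λ w)) =
        Function.update g₁ i (g₁ i * exp ((τ - t) • Λ w)) := by
      intro τ
      rw [hg₁, Function.update_idem, Function.update_self]
      congr 1
      rw [Matrix.mul_assoc, ← exp_add_smul, add_sub_cancel]
    simp_rw [hshift]
    have hbase := hD i (Λ w) g₁ (hΛ w) hg₁U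
    -- `hbase` is the derivative at `0` of `u ↦ Φ (update g₁ i (g₁ i * exp (u • Λ w)))`; precompose with `τ ↦ τ - t`
    have hcomp := HasDerivAt.comp_sub_const t t (by rw [sub_self]; exact hbase)
    have hfun : (fun τ : ℝ => Φ (Function.update g₁ i (g₁ i * exp ((τ - t) • Λ w)))) =
        fun τ : ℝ => (fun u : ℝ => Φ (Function.update g₁ i (g₁ i * exp (u • Λ w)))) (τ - t) := rfl
    rw [hfun]
    exact hcomp

end Placewise

end Summit.HodgeConjecture.HodgeConjecture.Cruxes.HLiu418.K2LiuLieRayDifferentiability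

end
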